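import Literature.NumberTheory.GaloisCohomology.Howard2004.EngineDecompositionsOfSkewPairingIntendedProofs
import Summits.BirchSwinnertonDyer.BirchSwinnertonDyer.Theorems.PoitouTateSelmerStructureDualityConjHolds
import HarnessLib

set_option linter.dupNamespace false -- `…BirchSwinnertonDyer.BirchSwinnertonDyer…` is the cell's nested layout (D-0017)
set_option autoImplicit false

/-!
# G87 (Howard 2004, Thm. 1.6.1 as intended by its printed proof, F-161′) from the ONE print-as-INTENDED leaf C45.1″ —
# Poitou–Tate duality discharged by the tree (helper for `stub_h161` of stmt-BirchSwinnertonDyer-22642)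

`--supports` stmt-BirchSwinnertonDyer-22642 (`MuInequalityCoherentPair`; print leaf G87 = `thm161_dvrKolyvaginBound`,
by-name target F-161′ = `thm161_dvrKolyvaginBound_printIntended`, cell `pub/bsd-print-x9`; seat x10b-p1-w7 g12, «TWIN″» after the
cell referee's READING RULING REF-177 «HU-AXIS OF C45.1′»).  THEOREMS ONLY (no definition, no named fact, no `sorry`).

The Literature closing term `DVRSetting.thm161_printIntended_of_prop141_printIntended` (x10b-p1-w7 g12, «C451″-GLUE») proves
F-161′ from the cite-only print fact C45.1″ `prop141_casselsTate_skewPairing_atLevel_printIntended` (Howard Prop. 1.4.1 /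
Thm. 1.4.2 as applied, AS INTENDED: under `(p : R) ≠ 0` and `p ∤ #𝓞_K^×`) and a binder
`∀ K, poitouTate_selmerStructure_duality_conj K`.  The latter is a THEOREM of the tree at every number field:
`InputsPoitouTateSelmer.poitouTate_selmerStructure_duality_conj_holds K` (route-free module
`Theorems.PoitouTateSelmerStructureDualityConjHolds`).  This file discharges it, leaving F-161′ conditional on C45.1″ ALONE —
the twin of `thm161_printIntended_of_prop141` (x10b-p1-w2 g17, keyed on the as-worded leaf C45.1′) for the as-intended leaf.

Honest framing: CONDITIONAL on the cite-only print fact C45.1″; the verbatim-as-worded F-161 (no guards) is not proved;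
no crux and no summit statement is proved; the Birch–Swinnerton-Dyer conjecture is NOT proved by any of this.
References: [Howard2004HeegnerKolyvagin] Thm. 1.6.1, Prop. 1.4.1, Thm. 1.4.2, Lemma 1.5.1; [MilneADT2006] Ch. I, Thm. 4.10 (b).
-/

namespace Summit.BirchSwinnertonDyer.BirchSwinnertonDyer.Theorems.HowardThm161PrintIntended

open Literature.NumberTheory.GaloisCohomology
open Literature.NumberTheory.GaloisCohomology.Howard2004

/-- **Howard 2004, Thm. 1.6.1 as intended by its printed proof (F-161′) from the print-as-intended leaf C45.1″ alone**:
`prop141_casselsTate_skewPairing_atLevel_printIntended → thm161_dvrKolyvaginBound_printIntended`, Poitou–Tate duality for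
Selmer structures being supplied by the tree (`poitouTate_selmerStructure_duality_conj_holds`).  Conditional on C45.1″; the
as-worded F-161 is not proved; BSD is not proved by this.
[cite: Howard2004HeegnerKolyvagin, Thm. 1.6.1 (arXiv:1202.6340 Thm. 2.6.1, p. 11 L17–32), Prop. 1.4.1, Thm. 1.4.2, Lemma 1.5.1]
[cite: MilneADT2006, Ch. I, Thm. 4.10 (b)] -/
theorem thm161_printIntended_of_prop141_printIntended
    (h141 : prop141_casselsTate_skewPairing_atLevel_printIntended) :
    thm161_dvrKolyvaginBound_printIntended :=
  DVRSetting.thm161_printIntended_of_prop141_printIntended h141 fun K _ _ =>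
    InputsPoitouTateSelmer.poitouTate_selmerStructure_duality_conj_holds K

end Summit.BirchSwinnertonDyer.BirchSwinnertonDyer.Theorems.HowardThm161PrintIntended
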